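import Summits.QuantumFields.BalabanUV.Beta.GAN24.BondNullComposition
import Summits.QuantumFields.BalabanUV.Beta.TameKernelCalculus

/-!
# `BalabanUV.Beta.GAN24.MultiplierExchangeBondSums` — binder row G-an2-4 / (CONV-C), W-slot, road «W3» (SKELETON-W3 §7.2 / §8.3 (F2)),
# «W3-ZB*» part 5b: IN THE BOND SUMS OF leaf-06's EXCHANGE DOUBLE-LEG SUMS EVERY PIECE WITH A MULTIPLIER-COLUMN VERTEX VANISHES —
# `Σ_{u′} Σ'_{(y,w)} ((dM_b ∘ K) ∘ dM_b′) y w f g = Σ_{u′} Σ'_{(y,w)} ((vertexOfK_b ∘ K) ∘ vertexOfK_b′) y w f g` and the `D₂` twin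
# (as `HasSum`-zero identities; `b = (κ,u)` fixed, `b′ = (κ′,u′)` summed), generic `K` + the step instances `unitK s_f s_m (KInvStep Lc j)`
# (idle leaf seat `b2b-balaban-gan24-formalise-leaf-14`, gen 23, invitation «W3-ZB*» part 5b; name provisional — the row owner may re-home it)

NOT IN PRINT; OUR BOOKKEEPING.  HONEST FRAMING (cell contract, verbatim): «discharging `BetaPertH` makes Bałaban's UV stability
UNCONDITIONAL — a real constructive-QFT result; it is NOT the continuum limit and NOT the Clay problem.»  HONEST DEPENDENCY (verbatim):
«continuum YM on T⁴ ⇐ BetaPertH ∧ nine spine estimates (0/9 proved); BetaPertH ⇐ (D1) ∧ (D4) ∧ CAP+tail; G-an2-4 gates asym, D1 and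
NE2/3/4.»  [folklore] kernel algebra in an5's tame currency (`TameKernelCalculus.comp_add_left/right_tame`, `Loc`, `Spr`) + the Fubini bricks of
part 5a (`BondNullComposition`) and part 4b (`MixedChannelBondSums.hasSum_firstBond_of_secondBond`) over TREE objects BY NAME: an4's
`OneStepKernelFamily.vertexOfK` ∕ `vertexFamily_vertexOfK` ∕ `KInvStep`, an2's `SecondOrderResponse.vertexOfM` ∕ `dM` ∕ `vertexFamily_vertexOfM` ∕
`vertexOfK_shiftK_translate₂` ∕ `vertexOfM_shiftK_translate₂`, leaf-06's `KernelLegCharges.summable_prod_of_biLoc` ∕ `tsum_prod_shiftK`, this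
lineage's (S2c) `MultiplierVertexBondSum.hasSum_vertexOfM_bond` ∕ `MultiplierZeroMass`; no estimate about Bałaban's tables, no cited fact, no `def`,
no `def … : Prop`, no wall binder; 0 sorry.  Discharges NOTHING of ROW W3-F2a ∕ F2b, «T2Shape» ∕ «T2SupRate» ∕ (hW, hWall); NOT «W-slot closed»,
NEVER «G-an2-4 closed»; NOT BetaPertH, NOT continuum, NOT Clay.

WHY (the located use).  leaf-06's `ExchangeReadout.hasSum_mmRead_K3OfK_unitKStep`: the ff block of `mmRead Lc (K3OfK K♮ Lc S M W b b′)` summed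
over the two coarse points is `−(s_f s_m σ_j)² · (D₁ + D₂ − Σ' W b b′)`, `D₁ = Σ'_{(y,w)} ((dM_b ∘ K♮) ∘ dM_b′)`, `D₂ = Σ'_{(y,w)} ((dM_b′ ∘ K♮) ∘ dM_b)`,
with `dM = vertexOfK … S + vertexOfM … M` (Lagrangian chart: field column + multiplier column).  Parts 4∕4b removed the mixed table from the
`W`-term; THIS part removes every multiplier-column vertex from `D₁`, `D₂` along the bond sum (SKELETON-W3 §7.2: «the surviving multiplier
vectors … die on K̃_mm by (S2c)»), so that ROW W3-F2a's remaining bond sums are PURE-FIELD (`vertexOfK` twice; (Q-lin)∕(S3c), leaf-02∕06):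
* §1 bookkeeping: `summable_prod_of_loc`, `loc_vertexOfK`, `loc_vertexOfM`, `tsum_prod_exchange_translate` (joint translation invariance of
  the double-leg sums of `(A_v ∘ K) ∘ B_w` for covariant vertex families);
* §2 THE SIX VANISHING BOND SUMS: `hasSum_tsum_prod_vKKvM` (`(vertexOfK_b∘K)∘vertexOfM_b′`), `hasSum_tsum_prod_vMKvM`, `hasSum_tsum_prod_vMKvK_left`
  (`(vertexOfM_b′∘K)∘vertexOfK_b`), `hasSum_tsum_prod_vMKvM_left` — part 5a directly —, and the two with the multiplier vertex at the FIXED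
  bond, `hasSum_tsum_prod_vMKvK_swap` (`(vertexOfM_b∘K)∘vertexOfK_b′`) ∕ `hasSum_tsum_prod_vKKvM_swap` (`(vertexOfK_b′∘K)∘vertexOfM_b`) — by
  TRANSPOSITION (part 4b) under block covariance of `K`, `S`, `M`;
* §3 THE TWO REDUCTIONS **`hasSum_tsum_prod_D1_sub_field`**, **`hasSum_tsum_prod_D2_sub_field`**;
* §4 the STEP INSTANCES `…_unitKStep` (`K♮_j = unitK s_f s_m (KInvStep Lc j)`, `N = Lc`; all `K`-hypotheses BY NAME).
-/

noncomputable section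

open Finset
open scoped BigOperators

namespace Summit.QuantumFields.BalabanUV.Beta.GAN24.MultiplierExchangeBondSums

open Literature.MathematicalPhysics.QuantumFieldTheory
open Literature.MathematicalPhysics.QuantumFieldTheory.Balaban1983to89
open Literature.MathematicalPhysics.QuantumFieldTheory.Balaban1983to89.Beta
open AffineAveraging (Site)
open B12Sec2to5 (l1 l1_nonneg)
open ExpKernelCalculus (MKer Decays BiLoc VertexFamily comp shiftK Zl comp_shiftK)
open OneStepResolventKernel (Fib LocStencil biLoc_mono decays_mono)
open OneStepKernelFamily (KInvStep decays_KInvStep colH vertexOfK vertexFamily_vertexOfK)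
open BalabanStepJets (locStencil_mono)
open SecondOrderResponse (colM vertexOfM dM vertexFamily_vertexOfM vertexOfK_shiftK_translate₂ vertexOfM_shiftK_translate₂)
open Summit.QuantumFields.BalabanUV.Beta.HessKerDressedUnits (unitK decays_unitK)
open Summit.QuantumFields.BalabanUV.Beta.TameKernelCalculus (Spr Loc Tame comp_add_left_tame comp_add_right_tame)
open Summit.QuantumFields.BalabanUV.Beta.GAN24.KernelLegCharges (summable_prod_of_biLoc tsum_prod_shiftK)
open Summit.QuantumFields.BalabanUV.Beta.GAN24.MultiplierZeroMass (hasSum_colM_unitK_KInvStep_bond)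
open Summit.QuantumFields.BalabanUV.Beta.GAN24.MultiplierVertexBondSum (hasSum_vertexOfM_bond)
open Summit.QuantumFields.BalabanUV.Beta.GAN24.MixedChannelZeroMode (shiftK_unitK_KInvStep)
open Summit.QuantumFields.BalabanUV.Beta.GAN24.MixedChannelBondSums (hasSum_firstBond_of_secondBond)
open Summit.QuantumFields.BalabanUV.Beta.GAN24.BondNullComposition (hasSum_tsum_prod_fixedK_bondNull hasSum_tsum_prod_bondNullK_fixed)

variable {d : ℕ}

/-! ## §1 Bookkeeping -/

section Book

variable {N : ℕ} [NeZero N]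

/-- [folklore] A localised kernel (an5's existential `Loc`) is absolutely summable over its two legs. -/
theorem summable_prod_of_loc {X : MKer (d + 1) (Fib d)} (h : Loc X) (f g : Fib d) :
    Summable fun yw : Site (d + 1) × Site (d + 1) => X yw.1 yw.2 f g := by
  obtain ⟨p, q, C, δ, hδ, hX⟩ := h
  exact summable_prod_of_biLoc hX hδ f g

omit [NeZero N] in
/-- [folklore] The field-column vertex of a decaying kernel against a local stencil family is localised. -/
theorem loc_vertexOfK {K : MKer (d + 1) (Fib d)} {C m : ℝ} (hK : Decays K C m) (hm : 0 < m)
    {S : Fin (d + 1) → Site (d + 1) → MKer (d + 1) (Fib d)} {Cs : ℝ} (hS : LocStencil S Cs m)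
    (μ : Fin (d + 1)) (y : Site (d + 1)) : Loc (vertexOfK K N S μ y) :=
  ⟨_, _, _, m / 2, half_pos hm, vertexFamily_vertexOfK (N := N) hK (hK.nonneg (Sum.inl 0)) hS hm le_rfl μ y⟩

/-- [folklore] The multiplier-column vertex of a decaying kernel against a vertex-family table is localised. -/
theorem loc_vertexOfM {K : MKer (d + 1) (Fib d)} {C m : ℝ} (hK : Decays K C m) (hm : 0 < m)
    {M : Fin (d + 1) → Site (d + 1) → MKer (d + 1) (Fib d)} {CM : ℝ} (hM : VertexFamily M N CM m)
    (μ : Fin (d + 1)) (y : Site (d + 1)) : Loc (vertexOfM K N M μ y) :=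
  ⟨_, _, _, m / 2, half_pos hm, vertexFamily_vertexOfM (N := N) hK (hK.nonneg (Sum.inl 0)) hM hm le_rfl μ y⟩

omit [NeZero N] in
/-- [folklore] **JOINT TRANSLATION INVARIANCE OF THE EXCHANGE DOUBLE-LEG SUMS**: for two vertex families covariant under the block shifts
(`A (v + t) = shiftK (−N•t) (A v)`, `B (w + t) = shiftK (−N•t) (B w)`) and a block-covariant `K`,
`Σ'_{(y,w)} ((A (v+t) ∘ K) ∘ B (w+t)) y w f g = Σ'_{(y,w)} ((A v ∘ K) ∘ B w) y w f g` (`comp_shiftK` twice ⨾ `tsum_prod_shiftK`). -/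
theorem tsum_prod_exchange_translate {K : MKer (d + 1) (Fib d)} (hKs : ∀ t, shiftK (-((N : ℤ) • t)) K = K)
    {A B : Site (d + 1) → MKer (d + 1) (Fib d)}
    (hA : ∀ v t, A (v + t) = shiftK (-((N : ℤ) • t)) (A v)) (hB : ∀ w t, B (w + t) = shiftK (-((N : ℤ) • t)) (B w))
    (v w t : Site (d + 1)) (f g : Fib d) :
    (∑' yw : Site (d + 1) × Site (d + 1), comp (comp (A (v + t)) K) (B (w + t)) yw.1 yw.2 f g)
      = ∑' yw : Site (d + 1) × Site (d + 1), comp (comp (A v) K) (B w) yw.1 yw.2 f g := by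
  rw [hA v t, hB w t]
  conv_lhs => rw [← hKs t, comp_shiftK, comp_shiftK]
  exact tsum_prod_shiftK _ _ f g

end Book

/-! ## §2 The six vanishing bond sums -/

section Six

variable {N : ℕ} [NeZero N] {K : MKer (d + 1) (Fib d)} {C m : ℝ}
  {S M : Fin (d + 1) → Site (d + 1) → MKer (d + 1) (Fib d)} {Cs CM : ℝ}

/-- [folklore] **`(vertexOfK_b ∘ K) ∘ vertexOfM_b′`, summed over `b′`, vanishes** (field column fixed at `b = (κ, u)`; the multiplier column at
the summed bond is bond-null by (S2c)). -/
theorem hasSum_tsum_prod_vKKvM (hK : Decays K C m) (hm : 0 < m)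
    (hK0 : ∀ μ ρ w, HasSum (fun y : Site (d + 1) => colM K N μ y ρ w) 0)
    (hS : LocStencil S Cs m) (hM : VertexFamily M N CM m) (κ : Fin (d + 1)) (u : Site (d + 1)) (κ' : Fin (d + 1)) (f g : Fib d) :
    HasSum (fun u' : Site (d + 1) => ∑' yw : Site (d + 1) × Site (d + 1),
      comp (comp (vertexOfK K N S κ u) K) (vertexOfM K N M κ' u') yw.1 yw.2 f g) 0 := by
  have hC : 0 ≤ C := hK.nonneg (Sum.inl 0)
  have hm2 : 0 < m / 2 := half_pos hm
  exact hasSum_tsum_prod_fixedK_bondNull (decays_mono hK hC le_rfl (by linarith)) hm2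
    (vertexFamily_vertexOfK (N := N) hK hC hS hm le_rfl κ u) (fun u' => vertexFamily_vertexOfM (N := N) hK hC hM hm le_rfl κ' u')
    (fun w₁ w g₁ g' => hasSum_vertexOfM_bond hK hm hK0 hM hm κ' w₁ w g₁ g') f g

/-- [folklore] **`(vertexOfM_b ∘ K) ∘ vertexOfM_b′`, summed over `b′`, vanishes.** -/
theorem hasSum_tsum_prod_vMKvM (hK : Decays K C m) (hm : 0 < m)
    (hK0 : ∀ μ ρ w, HasSum (fun y : Site (d + 1) => colM K N μ y ρ w) 0)
    (hM : VertexFamily M N CM m) (κ : Fin (d + 1)) (u : Site (d + 1)) (κ' : Fin (d + 1)) (f g : Fib d) :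
    HasSum (fun u' : Site (d + 1) => ∑' yw : Site (d + 1) × Site (d + 1),
      comp (comp (vertexOfM K N M κ u) K) (vertexOfM K N M κ' u') yw.1 yw.2 f g) 0 := by
  have hC : 0 ≤ C := hK.nonneg (Sum.inl 0)
  have hm2 : 0 < m / 2 := half_pos hm
  exact hasSum_tsum_prod_fixedK_bondNull (decays_mono hK hC le_rfl (by linarith)) hm2
    (vertexFamily_vertexOfM (N := N) hK hC hM hm le_rfl κ u) (fun u' => vertexFamily_vertexOfM (N := N) hK hC hM hm le_rfl κ' u')
    (fun w₁ w g₁ g' => hasSum_vertexOfM_bond hK hm hK0 hM hm κ' w₁ w g₁ g') f g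

/-- [folklore] **`(vertexOfM_b′ ∘ K) ∘ vertexOfK_b`, summed over `b′`, vanishes** (the multiplier column at the summed bond on the LEFT). -/
theorem hasSum_tsum_prod_vMKvK_left (hK : Decays K C m) (hm : 0 < m)
    (hK0 : ∀ μ ρ w, HasSum (fun y : Site (d + 1) => colM K N μ y ρ w) 0)
    (hS : LocStencil S Cs m) (hM : VertexFamily M N CM m) (κ : Fin (d + 1)) (u : Site (d + 1)) (κ' : Fin (d + 1)) (f g : Fib d) :
    HasSum (fun u' : Site (d + 1) => ∑' yw : Site (d + 1) × Site (d + 1),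
      comp (comp (vertexOfM K N M κ' u') K) (vertexOfK K N S κ u) yw.1 yw.2 f g) 0 := by
  have hC : 0 ≤ C := hK.nonneg (Sum.inl 0)
  have hm2 : 0 < m / 2 := half_pos hm
  exact hasSum_tsum_prod_bondNullK_fixed (decays_mono hK hC le_rfl (by linarith)) hm2
    (vertexFamily_vertexOfK (N := N) hK hC hS hm le_rfl κ u) (fun u' => vertexFamily_vertexOfM (N := N) hK hC hM hm le_rfl κ' u')
    (fun y w₂ f' g₂ => hasSum_vertexOfM_bond hK hm hK0 hM hm κ' y w₂ f' g₂) f g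

/-- [folklore] **`(vertexOfM_b′ ∘ K) ∘ vertexOfM_b`, summed over `b′`, vanishes.** -/
theorem hasSum_tsum_prod_vMKvM_left (hK : Decays K C m) (hm : 0 < m)
    (hK0 : ∀ μ ρ w, HasSum (fun y : Site (d + 1) => colM K N μ y ρ w) 0)
    (hM : VertexFamily M N CM m) (κ : Fin (d + 1)) (u : Site (d + 1)) (κ' : Fin (d + 1)) (f g : Fib d) :
    HasSum (fun u' : Site (d + 1) => ∑' yw : Site (d + 1) × Site (d + 1),
      comp (comp (vertexOfM K N M κ' u') K) (vertexOfM K N M κ u) yw.1 yw.2 f g) 0 := by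
  have hC : 0 ≤ C := hK.nonneg (Sum.inl 0)
  have hm2 : 0 < m / 2 := half_pos hm
  exact hasSum_tsum_prod_bondNullK_fixed (decays_mono hK hC le_rfl (by linarith)) hm2
    (vertexFamily_vertexOfM (N := N) hK hC hM hm le_rfl κ u) (fun u' => vertexFamily_vertexOfM (N := N) hK hC hM hm le_rfl κ' u')
    (fun y w₂ f' g₂ => hasSum_vertexOfM_bond hK hm hK0 hM hm κ' y w₂ f' g₂) f g

variable (hKs : ∀ t, shiftK (-((N : ℤ) • t)) K = K)
  (hSt : ∀ (κ : Fin (d + 1)) (u t : Site (d + 1)), S κ (u + (N : ℤ) • t) = shiftK (-((N : ℤ) • t)) (S κ u))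
  (hMt : ∀ (ρ : Fin (d + 1)) (w t : Site (d + 1)), M ρ (w + t) = shiftK (-((N : ℤ) • t)) (M ρ w))
include hKs hSt hMt

omit [NeZero N] hMt in
/-- [folklore] Block covariance of the field-column vertex family (an2's two-family lemma at `F = G = S` + `K`'s block covariance). -/
theorem vertexOfK_translate' (κ : Fin (d + 1)) (v t : Site (d + 1)) :
    vertexOfK K N S κ (v + t) = shiftK (-((N : ℤ) • t)) (vertexOfK K N S κ v) := by
  have h := vertexOfK_shiftK_translate₂ (N := N) K (F := S) (G := S) (t := t) (fun κ u => hSt κ u t) κ v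
  rwa [hKs t] at h

omit hSt in
/-- [folklore] Block covariance of the multiplier-column vertex family. -/
theorem vertexOfM_translate' (ρ : Fin (d + 1)) (w t : Site (d + 1)) :
    vertexOfM K N M ρ (w + t) = shiftK (-((N : ℤ) • t)) (vertexOfM K N M ρ w) := by
  have h := vertexOfM_shiftK_translate₂ (N := N) K (F := M) (G := M) (t := t) (fun ρ w => hMt ρ w t) ρ w
  rwa [hKs t] at h

/-- [folklore] **`(vertexOfM_b ∘ K) ∘ vertexOfK_b′`, summed over `b′`, vanishes** — the multiplier column sits at the FIXED bond `b`; by joint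
translation invariance the bond sum over `b′` equals a bond sum over `b` (part 4b's transposition), where (S2c) bites. -/
theorem hasSum_tsum_prod_vMKvK_swap (hK : Decays K C m) (hm : 0 < m)
    (hK0 : ∀ μ ρ w, HasSum (fun y : Site (d + 1) => colM K N μ y ρ w) 0)
    (hS : LocStencil S Cs m) (hM : VertexFamily M N CM m) (κ : Fin (d + 1)) (u : Site (d + 1)) (κ' : Fin (d + 1)) (f g : Fib d) :
    HasSum (fun u' : Site (d + 1) => ∑' yw : Site (d + 1) × Site (d + 1),
      comp (comp (vertexOfM K N M κ u) K) (vertexOfK K N S κ' u') yw.1 yw.2 f g) 0 :=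
  hasSum_firstBond_of_secondBond
    (G := fun v w => ∑' yw : Site (d + 1) × Site (d + 1), comp (comp (vertexOfM K N M κ w) K) (vertexOfK K N S κ' v) yw.1 yw.2 f g)
    (fun v w t => tsum_prod_exchange_translate hKs (fun w' t' => vertexOfM_translate' hKs hMt κ w' t')
      (fun v' t' => vertexOfK_translate' hKs hSt κ' v' t') w v t f g) 0 u
    (hasSum_tsum_prod_vMKvK_left hK hm hK0 hS hM κ' 0 κ f g)

/-- [folklore] **`(vertexOfK_b′ ∘ K) ∘ vertexOfM_b`, summed over `b′`, vanishes** (multiplier column at the fixed bond, on the right; transposition). -/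
theorem hasSum_tsum_prod_vKKvM_swap (hK : Decays K C m) (hm : 0 < m)
    (hK0 : ∀ μ ρ w, HasSum (fun y : Site (d + 1) => colM K N μ y ρ w) 0)
    (hS : LocStencil S Cs m) (hM : VertexFamily M N CM m) (κ : Fin (d + 1)) (u : Site (d + 1)) (κ' : Fin (d + 1)) (f g : Fib d) :
    HasSum (fun u' : Site (d + 1) => ∑' yw : Site (d + 1) × Site (d + 1),
      comp (comp (vertexOfK K N S κ' u') K) (vertexOfM K N M κ u) yw.1 yw.2 f g) 0 :=
  hasSum_firstBond_of_secondBond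
    (G := fun v w => ∑' yw : Site (d + 1) × Site (d + 1), comp (comp (vertexOfK K N S κ' v) K) (vertexOfM K N M κ w) yw.1 yw.2 f g)
    (fun v w t => tsum_prod_exchange_translate hKs (fun v' t' => vertexOfK_translate' hKs hSt κ' v' t')
      (fun w' t' => vertexOfM_translate' hKs hMt κ w' t') v w t f g) 0 u
    (hasSum_tsum_prod_vKKvM hK hm hK0 hS hM κ' 0 κ f g)

end Six

/-! ## §3 The two reductions -/

section Reductions

variable {N : ℕ} [NeZero N] {K : MKer (d + 1) (Fib d)} {C m : ℝ}
  {S M : Fin (d + 1) → Site (d + 1) → MKer (d + 1) (Fib d)} {Cs CM : ℝ}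

/-- [folklore] The exchange kernel `(dM_b ∘ K) ∘ dM_b′` expanded along `dM = vertexOfK + vertexOfM` (an5's tame additivity; every factor
localised or spread). -/
theorem exchange_expand (hK : Decays K C m) (hm : 0 < m) (hS : LocStencil S Cs m) (hM : VertexFamily M N CM m)
    (μ : Fin (d + 1)) (y : Site (d + 1)) (ν : Fin (d + 1)) (y' : Site (d + 1)) :
    comp (comp (dM K N S M μ y) K) (dM K N S M ν y')
      = comp (comp (vertexOfK K N S μ y) K) (vertexOfK K N S ν y') + comp (comp (vertexOfK K N S μ y) K) (vertexOfM K N M ν y')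
        + (comp (comp (vertexOfM K N M μ y) K) (vertexOfK K N S ν y') + comp (comp (vertexOfM K N M μ y) K) (vertexOfM K N M ν y')) := by
  have sK : Spr K := ⟨C, m, hm, hK⟩
  have lA := loc_vertexOfK (N := N) hK hm hS μ y
  have lB := loc_vertexOfM (N := N) hK hm hM μ y
  have lA' := loc_vertexOfK (N := N) hK hm hS ν y'
  have lB' := loc_vertexOfM (N := N) hK hm hM ν y'
  have hdM : ∀ (κ : Fin (d + 1)) (u : Site (d + 1)), dM K N S M κ u = vertexOfK K N S κ u + vertexOfM K N M κ u := fun κ u => rfl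
  rw [hdM μ y, hdM ν y', comp_add_left_tame lA.tame lB.tame sK.tame,
    comp_add_left_tame (lA.comp_spr sK).tame (lB.comp_spr sK).tame (lA'.add lB').tame,
    comp_add_right_tame (lA.comp_spr sK).tame lA'.tame lB'.tame, comp_add_right_tame (lB.comp_spr sK).tame lA'.tame lB'.tame]

/-- [folklore] **REDUCTION OF `D₁`**: along the bond `b′ = (κ′, u′)` (at fixed `b = (κ, u)`, any fibre pair), the double-leg sums of the exchange
kernel `(dM_b ∘ K) ∘ dM_b′` and of its PURE-FIELD part `(vertexOfK_b ∘ K) ∘ vertexOfK_b′` have the same bond sum: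
`HasSum (u′ ↦ Σ'_{(y,w)} ((dM_b ∘ K) ∘ dM_b′) y w f g − Σ'_{(y,w)} ((vertexOfK_b ∘ K) ∘ vertexOfK_b′) y w f g) 0`
(`K` decaying + block covariant with zero `colM` bond masses; `S` a block-covariant `LocStencil`, `M` a block-covariant `VertexFamily`). -/
theorem hasSum_tsum_prod_D1_sub_field (hK : Decays K C m) (hm : 0 < m) (hKs : ∀ t, shiftK (-((N : ℤ) • t)) K = K)
    (hK0 : ∀ μ ρ w, HasSum (fun y : Site (d + 1) => colM K N μ y ρ w) 0)
    (hS : LocStencil S Cs m) (hM : VertexFamily M N CM m)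
    (hSt : ∀ (κ : Fin (d + 1)) (u t : Site (d + 1)), S κ (u + (N : ℤ) • t) = shiftK (-((N : ℤ) • t)) (S κ u))
    (hMt : ∀ (ρ : Fin (d + 1)) (w t : Site (d + 1)), M ρ (w + t) = shiftK (-((N : ℤ) • t)) (M ρ w))
    (κ : Fin (d + 1)) (u : Site (d + 1)) (κ' : Fin (d + 1)) (f g : Fib d) :
    HasSum (fun u' : Site (d + 1) =>
      (∑' yw : Site (d + 1) × Site (d + 1), comp (comp (dM K N S M κ u) K) (dM K N S M κ' u') yw.1 yw.2 f g)
        - ∑' yw : Site (d + 1) × Site (d + 1), comp (comp (vertexOfK K N S κ u) K) (vertexOfK K N S κ' u') yw.1 yw.2 f g) 0 := by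
  have sK : Spr K := ⟨C, m, hm, hK⟩
  have lA := loc_vertexOfK (N := N) hK hm hS κ u
  have lB := loc_vertexOfM (N := N) hK hm hM κ u
  have e : ∀ u' : Site (d + 1),
      (∑' yw : Site (d + 1) × Site (d + 1), comp (comp (dM K N S M κ u) K) (dM K N S M κ' u') yw.1 yw.2 f g)
        - (∑' yw : Site (d + 1) × Site (d + 1), comp (comp (vertexOfK K N S κ u) K) (vertexOfK K N S κ' u') yw.1 yw.2 f g)
        = (∑' yw : Site (d + 1) × Site (d + 1), comp (comp (vertexOfK K N S κ u) K) (vertexOfM K N M κ' u') yw.1 yw.2 f g)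
          + ((∑' yw : Site (d + 1) × Site (d + 1), comp (comp (vertexOfM K N M κ u) K) (vertexOfK K N S κ' u') yw.1 yw.2 f g)
            + ∑' yw : Site (d + 1) × Site (d + 1), comp (comp (vertexOfM K N M κ u) K) (vertexOfM K N M κ' u') yw.1 yw.2 f g) := by
    intro u'
    have lA' := loc_vertexOfK (N := N) hK hm hS κ' u'
    have lB' := loc_vertexOfM (N := N) hK hm hM κ' u'
    have s1 := summable_prod_of_loc ((lA.comp_spr sK).comp lA') f g
    have s2 := summable_prod_of_loc ((lA.comp_spr sK).comp lB') f g
    have s3 := summable_prod_of_loc ((lB.comp_spr sK).comp lA') f g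
    have s4 := summable_prod_of_loc ((lB.comp_spr sK).comp lB') f g
    rw [exchange_expand hK hm hS hM κ u κ' u']
    simp only [Pi.add_apply]
    rw [(s1.add s2).tsum_add (s3.add s4), s1.tsum_add s2, s3.tsum_add s4]
    ring
  simp_rw [e]
  have h := (hasSum_tsum_prod_vKKvM hK hm hK0 hS hM κ u κ' f g).add
    ((hasSum_tsum_prod_vMKvK_swap hKs hSt hMt hK hm hK0 hS hM κ u κ' f g).add (hasSum_tsum_prod_vMKvM hK hm hK0 hM κ u κ' f g))
  simpa only [add_zero] using h

/-- [folklore] **REDUCTION OF `D₂`**: along the bond `b′`, the double-leg sums of `(dM_b′ ∘ K) ∘ dM_b` and of `(vertexOfK_b′ ∘ K) ∘ vertexOfK_b`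
have the same bond sum (as a `HasSum`-zero identity). -/
theorem hasSum_tsum_prod_D2_sub_field (hK : Decays K C m) (hm : 0 < m) (hKs : ∀ t, shiftK (-((N : ℤ) • t)) K = K)
    (hK0 : ∀ μ ρ w, HasSum (fun y : Site (d + 1) => colM K N μ y ρ w) 0)
    (hS : LocStencil S Cs m) (hM : VertexFamily M N CM m)
    (hSt : ∀ (κ : Fin (d + 1)) (u t : Site (d + 1)), S κ (u + (N : ℤ) • t) = shiftK (-((N : ℤ) • t)) (S κ u))
    (hMt : ∀ (ρ : Fin (d + 1)) (w t : Site (d + 1)), M ρ (w + t) = shiftK (-((N : ℤ) • t)) (M ρ w))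
    (κ : Fin (d + 1)) (u : Site (d + 1)) (κ' : Fin (d + 1)) (f g : Fib d) :
    HasSum (fun u' : Site (d + 1) =>
      (∑' yw : Site (d + 1) × Site (d + 1), comp (comp (dM K N S M κ' u') K) (dM K N S M κ u) yw.1 yw.2 f g)
        - ∑' yw : Site (d + 1) × Site (d + 1), comp (comp (vertexOfK K N S κ' u') K) (vertexOfK K N S κ u) yw.1 yw.2 f g) 0 := by
  have sK : Spr K := ⟨C, m, hm, hK⟩
  have lA := loc_vertexOfK (N := N) hK hm hS κ u
  have lB := loc_vertexOfM (N := N) hK hm hM κ u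
  have e : ∀ u' : Site (d + 1),
      (∑' yw : Site (d + 1) × Site (d + 1), comp (comp (dM K N S M κ' u') K) (dM K N S M κ u) yw.1 yw.2 f g)
        - (∑' yw : Site (d + 1) × Site (d + 1), comp (comp (vertexOfK K N S κ' u') K) (vertexOfK K N S κ u) yw.1 yw.2 f g)
        = (∑' yw : Site (d + 1) × Site (d + 1), comp (comp (vertexOfK K N S κ' u') K) (vertexOfM K N M κ u) yw.1 yw.2 f g)
          + ((∑' yw : Site (d + 1) × Site (d + 1), comp (comp (vertexOfM K N M κ' u') K) (vertexOfK K N S κ u) yw.1 yw.2 f g)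
            + ∑' yw : Site (d + 1) × Site (d + 1), comp (comp (vertexOfM K N M κ' u') K) (vertexOfM K N M κ u) yw.1 yw.2 f g) := by
    intro u'
    have lA' := loc_vertexOfK (N := N) hK hm hS κ' u'
    have lB' := loc_vertexOfM (N := N) hK hm hM κ' u'
    have s1 := summable_prod_of_loc ((lA'.comp_spr sK).comp lA) f g
    have s2 := summable_prod_of_loc ((lA'.comp_spr sK).comp lB) f g
    have s3 := summable_prod_of_loc ((lB'.comp_spr sK).comp lA) f g
    have s4 := summable_prod_of_loc ((lB'.comp_spr sK).comp lB) f g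
    rw [exchange_expand hK hm hS hM κ' u' κ u]
    simp only [Pi.add_apply]
    rw [(s1.add s2).tsum_add (s3.add s4), s1.tsum_add s2, s3.tsum_add s4]
    ring
  simp_rw [e]
  have h := (hasSum_tsum_prod_vKKvM_swap hKs hSt hMt hK hm hK0 hS hM κ u κ' f g).add
    ((hasSum_tsum_prod_vMKvK_left hK hm hK0 hS hM κ u κ' f g).add (hasSum_tsum_prod_vMKvM_left hK hm hK0 hM κ u κ' f g))
  simpa only [add_zero] using h

end Reductions

/-! ## §4 The step instances: `K♮_j = unitK s_f s_m (KInvStep Lc j)` at blocking `Lc` -/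

section Step

variable {Lc : ℕ} [NeZero Lc] (sf sm : ℝ) (j : ℕ)
  {S M : Fin (d + 1) → Site (d + 1) → MKer (d + 1) (Fib d)} {Cs δs CM δM : ℝ}
  (hS : LocStencil S Cs δs) (hδs : 0 < δs) (hM : VertexFamily M Lc CM δM) (hδM : 0 < δM)
  (hSt : ∀ (κ : Fin (d + 1)) (u t : Site (d + 1)), S κ (u + (Lc : ℤ) • t) = shiftK (-((Lc : ℤ) • t)) (S κ u))
  (hMt : ∀ (ρ : Fin (d + 1)) (w t : Site (d + 1)), M ρ (w + t) = shiftK (-((Lc : ℤ) • t)) (M ρ w))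
include hS hδs hM hδM hSt hMt

/-- [folklore] **REDUCTION OF `D₁` THROUGH THE STEP KERNEL**: for a block-covariant local stencil family `S` (rate `δs > 0`) and a block-covariant
vertex family `M` (rate `δM > 0`), all units, every `j`, every fixed bond `(κ, u)` and fibre pair, the bond sum of the double-leg sums of
`(dM_b ∘ K♮_j) ∘ dM_b′` equals that of `(vertexOfK_b ∘ K♮_j) ∘ vertexOfK_b′`. -/
theorem hasSum_tsum_prod_D1_sub_field_unitKStep (κ : Fin (d + 1)) (u : Site (d + 1)) (κ' : Fin (d + 1)) (f g : Fib d) :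
    HasSum (fun u' : Site (d + 1) =>
      (∑' yw : Site (d + 1) × Site (d + 1),
          comp (comp (dM (unitK sf sm (KInvStep (d := d) Lc j)) Lc S M κ u) (unitK sf sm (KInvStep (d := d) Lc j)))
            (dM (unitK sf sm (KInvStep (d := d) Lc j)) Lc S M κ' u') yw.1 yw.2 f g)
        - ∑' yw : Site (d + 1) × Site (d + 1),
          comp (comp (vertexOfK (unitK sf sm (KInvStep (d := d) Lc j)) Lc S κ u) (unitK sf sm (KInvStep (d := d) Lc j)))
            (vertexOfK (unitK sf sm (KInvStep (d := d) Lc j)) Lc S κ' u') yw.1 yw.2 f g) 0 := by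
  obtain ⟨δ, C, hδ, hC, hK⟩ := decays_KInvStep (d := d) (Lc := Lc) j
  have hKu := decays_unitK (sf := sf) (sm := sm) hK
  have hCs : 0 ≤ Cs := (hS 0 0).nonneg (Sum.inl 0)
  have hCM : 0 ≤ CM := (hM 0 0).nonneg (Sum.inl 0)
  set m : ℝ := min (min δ δs) δM with hm_def
  have hm : 0 < m := lt_min (lt_min hδ hδs) hδM
  have hKu' : Decays (unitK sf sm (KInvStep (d := d) Lc j)) (max |sf| |sm| * C * max |sf| |sm|) m :=
    decays_mono hKu (by positivity) le_rfl ((min_le_left _ _).trans (min_le_left _ _))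
  exact hasSum_tsum_prod_D1_sub_field hKu' hm (shiftK_unitK_KInvStep sf sm j)
    (fun μ ρ w => hasSum_colM_unitK_KInvStep_bond (Lc := Lc) sf sm j μ ρ w)
    (locStencil_mono hS hCs ((min_le_left _ _).trans (min_le_right _ _))) (fun μ y => biLoc_mono (hM μ y) hCM (min_le_right _ _))
    hSt hMt κ u κ' f g

/-- [folklore] **REDUCTION OF `D₂` THROUGH THE STEP KERNEL.** -/
theorem hasSum_tsum_prod_D2_sub_field_unitKStep (κ : Fin (d + 1)) (u : Site (d + 1)) (κ' : Fin (d + 1)) (f g : Fib d) :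
    HasSum (fun u' : Site (d + 1) =>
      (∑' yw : Site (d + 1) × Site (d + 1),
          comp (comp (dM (unitK sf sm (KInvStep (d := d) Lc j)) Lc S M κ' u') (unitK sf sm (KInvStep (d := d) Lc j)))
            (dM (unitK sf sm (KInvStep (d := d) Lc j)) Lc S M κ u) yw.1 yw.2 f g)
        - ∑' yw : Site (d + 1) × Site (d + 1),
          comp (comp (vertexOfK (unitK sf sm (KInvStep (d := d) Lc j)) Lc S κ' u') (unitK sf sm (KInvStep (d := d) Lc j)))
            (vertexOfK (unitK sf sm (KInvStep (d := d) Lc j)) Lc S κ u) yw.1 yw.2 f g) 0 := by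
  obtain ⟨δ, C, hδ, hC, hK⟩ := decays_KInvStep (d := d) (Lc := Lc) j
  have hKu := decays_unitK (sf := sf) (sm := sm) hK
  have hCs : 0 ≤ Cs := (hS 0 0).nonneg (Sum.inl 0)
  have hCM : 0 ≤ CM := (hM 0 0).nonneg (Sum.inl 0)
  set m : ℝ := min (min δ δs) δM with hm_def
  have hm : 0 < m := lt_min (lt_min hδ hδs) hδM
  have hKu' : Decays (unitK sf sm (KInvStep (d := d) Lc j)) (max |sf| |sm| * C * max |sf| |sm|) m :=
    decays_mono hKu (by positivity) le_rfl ((min_le_left _ _).trans (min_le_left _ _))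
  exact hasSum_tsum_prod_D2_sub_field hKu' hm (shiftK_unitK_KInvStep sf sm j)
    (fun μ ρ w => hasSum_colM_unitK_KInvStep_bond (Lc := Lc) sf sm j μ ρ w)
    (locStencil_mono hS hCs ((min_le_left _ _).trans (min_le_right _ _))) (fun μ y => biLoc_mono (hM μ y) hCM (min_le_right _ _))
    hSt hMt κ u κ' f g

end Step

end Summit.QuantumFields.BalabanUV.Beta.GAN24.MultiplierExchangeBondSums

end
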